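import Literature.Claims.NS.Geurdes2017
import Literature.Analysis.FluidPDE.BeltramiFlows
import Literature.Analysis.FluidPDE.PeriodicGalileanNonuniqueness
import HarnessLib

/-!
# C106 `Geurdes2017` — kernel refutations of Step 3a / Step 3 (`f^crl ∈ 𝒢`, §2.5 p.6)

Text of record: H. Geurdes, Cogent Mathematics 4 (2017) 1284293 ≡ arXiv:1703.05113 v1 (9 pp.),
typed skeleton `Literature.Claims.NS.Geurdes2017` (typist-3 g2, p473176; bib `Geurdes2017`).

§2.5 p.6 selects the STATIONARY force `f^crl(x,t) = f^crl(x,0) = ∇×u⁰(x) + 𝒟_{c,ν}u⁰(x)` (2.18)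
and asserts «and is in 𝒢, see (2.2)», verifying Fefferman's (9) «suppressing the notation of t = 0»,
i.e. at `t = 0` only ((2.19): «The constant K is no longer of importance»).  But 𝒢 (2.2) as printed
carries `|∂ₓ^α ∂ₜ^m f(x,t)| ≤ C_{α,m,K}(1+|t|)^{−K}` for arbitrary `K`: with `α = 0`, `m = 0`, `K = 1`
a time-independent member of 𝒢 vanishes identically.

* `not_Step3a_stationaryCriterion` — the abstract criterion (HYGIENE 13 grain) fails at the constant
  field `g ≡ e₁` (smooth, periodic, all derivatives bounded; `(1+t)·1 ≤ C` fails at `t = |C|+1`).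
* `not_Step3_fcrlInG` — the ON-PATH membership fails at the paper's own data: `ν = 1`, `c = e₃`,
  `u⁰ = U`, the 1-periodic ABC/Beltrami field `U(x) = abc 0 1 1 (2πx) = (cos 2πx₂, sin 2πx₁,
  sin 2πx₂ + cos 2πx₁)` (`∇×U = 2πU`, `∇·U = 0`, `ΔU = −4π²U`, `(e₃·∇)U = 0`), certified in 𝒰″
  (`dataSubclass_U`: non-constant, not a gradient, `∇×∇×U = 4π²U ≢ 0`, all derivatives bounded by
  periodicity + continuity), for which `f^crl = (2π + 1 + 4π²)U` and `‖f^crl(0)‖ ≥ 1` at every time.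

Tree facts used: `abc`, `curl_abc`, `isDivFree_abc`, `contDiff_abc`, `fderiv_abc_single`
(BeltramiFlows), `laplacian_eq_of_strongBeltrami`, `curl_gradient_eq_zero_holds`,
`IsLatticePeriodic.exists_forall_norm_le`.  Axioms: `propext`, `Classical.choice`, `Quot.sound`.
Refuter: ns-claims-refuter-5; filed under interim convention (b) by the paired salvage prover.

WHAT THIS IS NOT: not a claim about NS regularity or blow-up; not a claim about any author beyond the
typed locator.
-/

set_option linter.dupNamespace false

open Set Real
open scoped RealInnerProductSpace ContDiff Laplacian Topology

namespace Summit.NavierStokesRegularity.NavierStokesRegularity.Theorems.Geurdes2017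

open Literature.Analysis.FluidPDE Literature.Claims.NS.Geurdes2017

noncomputable section

/-! ## Step 3a: a stationary non-zero field has no `(1+t)^{-K}` decay -/

/-- A stationary force `f(t,x) = g(x)` with `‖g x₀‖ ≥ 1` for some `x₀` violates the decay clause
`HasRapidTimeDecay` of 𝒢 (2.2) (take `n = 0`, `K = 1`, `t = |C| + 1`).
[cite: Geurdes2017, eq. (2.2) p.3 and eq. (2.19) p.6] -/
theorem not_hasRapidTimeDecay_of_stationary
    {g : EuclideanSpace ℝ (Fin 3) → EuclideanSpace ℝ (Fin 3)} {x₀ : EuclideanSpace ℝ (Fin 3)}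
    (hg : 1 ≤ ‖g x₀‖) : ¬ HasRapidTimeDecay (fun _ : ℝ => g) := by
  intro hdec
  obtain ⟨C, hC⟩ := hdec 0 1
  have h1 := hC (|C| + 1) (by positivity) x₀
  rw [norm_iteratedFDerivWithin_zero] at h1
  have h2 : Function.uncurry (fun _ : ℝ => g) (|C| + 1, x₀) = g x₀ := rfl
  rw [h2, pow_one] at h1
  have h3 : (1 + (|C| + 1)) * 1 ≤ (1 + (|C| + 1)) * ‖g x₀‖ :=
    mul_le_mul_of_nonneg_left hg (by positivity)
  linarith [le_abs_self C]

/-- **Step 3a is false** (the printed criterion «(9) for a stationary force is (2.19); K no longer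
of importance», §2.5 p.6): the constant field `g ≡ e₁` is smooth, `ℤ³`-periodic, with all
derivatives bounded, yet the stationary force `(t,x) ↦ e₁` is not in 𝒢 (2.2) — `(1+t)‖e₁‖ ≤ C`
fails for `t > C`. [cite: Geurdes2017, §2.5 eq. (2.19) p.6 with eq. (2.2) p.3] -/
theorem not_Step3a_stationaryCriterion : ¬ Step3a_stationaryCriterion := by
  intro h
  have hbd : ∀ n : ℕ, ∃ C : ℝ, ∀ x : EuclideanSpace ℝ (Fin 3),
      ‖iteratedFDeriv ℝ n (fun _ : EuclideanSpace ℝ (Fin 3) =>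
        (EuclideanSpace.single 0 1 : EuclideanSpace ℝ (Fin 3))) x‖ ≤ C := by
    intro n
    refine ⟨1, fun x => ?_⟩
    rcases Nat.eq_zero_or_pos n with rfl | hn
    · rw [norm_iteratedFDeriv_zero]; simp
    · rw [iteratedFDeriv_const_of_ne hn.ne']; simp
  have hg := h (fun _ => EuclideanSpace.single 0 1) contDiff_const (fun j x => rfl) hbd
  exact not_hasRapidTimeDecay_of_stationary (x₀ := 0) (by simp) hg.2.2

/-! ## The datum `U ∈ 𝒰″`: the 1-periodic ABC field with `A = 0`, `B = C = 1` -/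

/-- `U(x) = abc 0 1 1 (2πx) = (cos 2πx₂, sin 2πx₁, sin 2πx₂ + cos 2πx₁)` (MB Example 2.8 rescaled to
period 1; independent of `x₃`). [cite: Geurdes2017, §2.6 p.6 (a member of 𝒰″)] -/
def U (x : EuclideanSpace ℝ (Fin 3)) : EuclideanSpace ℝ (Fin 3) :=
  ABC.abc 0 1 1 ((2 * π) • x)

/-- `U` is smooth. [folklore] -/
theorem contDiff_U {n : WithTop ℕ∞} : ContDiff ℝ n U :=
  (ABC.contDiff_abc 0 1 1).comp (contDiff_const_smul _)

/-- `U` is differentiable. [folklore] -/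
theorem differentiable_U : Differentiable ℝ U :=
  (contDiff_U (n := 1)).differentiable one_ne_zero

/-- Chain rule: `DU(x) = 2π · D(abc)(2πx)`. [folklore] -/
theorem fderiv_U (x : EuclideanSpace ℝ (Fin 3)) :
    fderiv ℝ U x = (2 * π) • fderiv ℝ (ABC.abc 0 1 1) ((2 * π) • x) :=
  fderiv_comp_smul (2 * π)

/-- `∇×U = 2πU` (strong Beltrami field with `λ = 2π`). [folklore] -/
theorem curl_U (x : EuclideanSpace ℝ (Fin 3)) : curl U x = (2 * π) • U x := by
  rw [curl_eq_curlCLM, fderiv_U, map_smul, ← curl_eq_curlCLM, ABC.curl_abc]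
  rfl

/-- `U` is a strong Beltrami field, coefficient `2π`. [folklore] -/
theorem isBeltrami_U : IsBeltrami U fun _ => 2 * π := curl_U

/-- `∇·U = 0`. [folklore] -/
theorem isDivFree_U : VectorCalculus.IsDivFree U := by
  intro x
  have h := ABC.isDivFree_abc 0 1 1 ((2 * π) • x)
  unfold VectorCalculus.divergence at h ⊢
  rw [fderiv_U, ContinuousLinearMap.toLinearMap_smul, map_smul, h, smul_zero]

/-- `ΔU = −4π²U`. [folklore] -/
theorem laplacian_U (x : EuclideanSpace ℝ (Fin 3)) : (Δ U) x = -((2 * π) ^ 2) • U x :=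
  laplacian_eq_of_strongBeltrami isBeltrami_U contDiff_U isDivFree_U x

/-- `(e₃·∇)U = 0`: `U` does not depend on `x₃`. [folklore] -/
theorem fderiv_U_e3 (x : EuclideanSpace ℝ (Fin 3)) :
    fderiv ℝ U x (EuclideanSpace.single 2 1) = 0 := by
  rw [fderiv_U]
  ext i
  rw [_root_.smul_apply, PiLp.smul_apply, ABC.fderiv_abc_single]
  fin_cases i <;> simp [ABC.jac]

/-- `U` is `ℤ³`-periodic. [folklore] -/
theorem periodic_U : IsLatticePeriodic U := by
  intro j x
  ext i
  fin_cases j <;> fin_cases i <;>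
    simp [U, Real.sin_add_two_pi, Real.cos_add_two_pi]

/-- `U 0 = (1, 0, 1)` componentwise. [folklore] -/
theorem U_zero : U 0 = !₂[(1 : ℝ), 0, 1] := by
  ext i; fin_cases i <;> simp [U]

/-- `‖U 0‖ ≥ 1` (its first component is `1`). [folklore] -/
theorem one_le_norm_U_zero : 1 ≤ ‖U 0‖ := by
  have h := PiLp.norm_apply_le (U 0) 0
  rw [U_zero] at h ⊢
  simpa using h

/-- `U 0 ≠ 0`. [folklore] -/
theorem U_zero_ne_zero : U 0 ≠ 0 := by
  intro h
  have := one_le_norm_U_zero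
  rw [h, norm_zero] at this
  linarith

/-- `U (¼e₁)` has second component `sin(π/2) = 1 ≠ 0 = (U 0)₂`: `U` is not constant. [folklore] -/
theorem U_not_const : ¬ ∃ a : EuclideanSpace ℝ (Fin 3), ∀ x, U x = a := by
  rintro ⟨a, ha⟩
  have h0 := congrArg (fun v : EuclideanSpace ℝ (Fin 3) => v 1) (ha 0)
  have h1 := congrArg (fun v : EuclideanSpace ℝ (Fin 3) => v 1) (ha (EuclideanSpace.single 0 (1 / 4)))
  simp [U] at h0 h1
  have : (2 * π * 4⁻¹ : ℝ) = π / 2 := by ring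
  rw [this, sin_pi_div_two] at h1
  linarith

/-- A differentiable potential whose gradient is `U` is `C²` (its derivative `x ↦ ⟪U x, ·⟫` is
smooth). [folklore] -/
theorem contDiff_two_of_gradient_eq {φ : EuclideanSpace ℝ (Fin 3) → ℝ} (hφ : Differentiable ℝ φ)
    (hU : ∀ x, U x = gradient φ x) : ContDiff ℝ 2 φ := by
  have hfd : ∀ x y, fderiv ℝ φ x y = ⟪U x, y⟫ := by
    intro x y
    rw [hU x, inner_gradient_left]
  have h1 : ContDiff ℝ 1 (fderiv ℝ φ) := by
    rw [contDiff_clm_apply_iff]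
    intro y
    have e : (fun x => fderiv ℝ φ x y) = fun x => ⟪U x, y⟫ := funext fun x => hfd x y
    rw [e]
    exact contDiff_U.inner ℝ contDiff_const
  have h2 : ContDiff ℝ ((1 : WithTop ℕ∞) + 1) φ := by
    rw [contDiff_succ_iff_fderiv]
    exact ⟨hφ, fun h => absurd h (by simp), h1⟩
  exact h2

/-- `U` is not a gradient (`∇×∇φ = 0` but `∇×U(0) = 2πU(0) ≠ 0`). [folklore] -/
theorem U_not_gradient :
    ¬ ∃ φ : EuclideanSpace ℝ (Fin 3) → ℝ, Differentiable ℝ φ ∧ ∀ x, U x = gradient φ x := by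
  rintro ⟨φ, hφ, hUφ⟩
  have h2 := contDiff_two_of_gradient_eq hφ hUφ
  have hc : curl (gradient φ) 0 = 0 := curl_gradient_eq_zero_holds φ h2 0
  have e : gradient φ = U := funext fun x => (hUφ x).symm
  rw [e, curl_U] at hc
  exact U_zero_ne_zero (by simpa [Real.pi_ne_zero] using hc)

/-- `∇×∇×U(0) = 4π²U(0) ≠ 0`. [folklore] -/
theorem curl_curl_U_zero_ne : curl (curl U) 0 ≠ 0 := by
  have e : curl U = fun x => (2 * π) • U x := funext curl_U
  rw [e, curl_const_smul (differentiable_U 0), curl_U, smul_smul]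
  exact smul_ne_zero (by positivity) U_zero_ne_zero

/-- All derivatives of `U` are bounded (each `DⁿU` is continuous and `ℤ³`-periodic). [folklore] -/
theorem iteratedFDeriv_U_bounded (n : ℕ) :
    ∃ C : ℝ, ∀ x, ‖iteratedFDeriv ℝ n U x‖ ≤ C := by
  have hper : IsLatticePeriodic (iteratedFDeriv ℝ n U) := by
    intro j x
    have h := iteratedFDeriv_comp_add_right (𝕜 := ℝ) (f := U) n (EuclideanSpace.single j 1) x
    rw [show (fun z => U (z + EuclideanSpace.single j 1)) = U from funext (periodic_U j)] at h
    exact h.symm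
  exact hper.exists_forall_norm_le ((contDiff_U (n := (n : WithTop ℕ∞))).continuous_iteratedFDeriv')

/-- **`U ∈ 𝒰″`** (§2.6 p.6): smooth, divergence free, `ℤ³`-periodic; not constant, not a gradient,
`∇×∇×U ≢ 0`, all derivatives bounded (2.20). [cite: Geurdes2017, §2.6 with eq. (2.20) p.6] -/
theorem dataSubclass_U : dataSubclass U :=
  ⟨⟨contDiff_U, isDivFree_U, periodic_U⟩, U_not_const, U_not_gradient, ⟨0, curl_curl_U_zero_ne⟩,
    iteratedFDeriv_U_bounded⟩

/-! ## Step 3 (on path): `f^crl ∉ 𝒢` for `(ν, c, u⁰) = (1, e₃, U)` -/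

/-- For `c = e₃`, `ν = 1`: `f^crl(x) = ∇×U + U + (e₃·∇)U − ΔU = (2π + 1 + 4π²)U(x)` at every time.
[cite: Geurdes2017, eq. (2.18) p.6] -/
theorem fcrl_U (t : ℝ) (x : EuclideanSpace ℝ (Fin 3)) :
    fcrl 1 (EuclideanSpace.single 2 1) U t x = (2 * π + 1 + (2 * π) ^ 2) • U x := by
  rw [fcrl_apply, curl_U, fderiv_U_e3, laplacian_U, one_smul, add_zero, add_smul, add_smul,
    one_smul, neg_smul, sub_neg_eq_add, add_assoc]

/-- **Step 3 is false ON THE PATH** (§2.5 (2.18) p.6 «f^crl … is in 𝒢»; p.7 «with f^crl ∈ 𝒢 and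
u⁰ ∈ 𝒰″»): for `ν = 1`, `c = e₃ ≠ 0` and the datum `U ∈ 𝒰″`, the stationary force
`f^crl = (2π + 1 + 4π²)U` has `‖f^crl(t, 0)‖ ≥ 1` for all `t`, so it violates the decay (9) of 𝒢.
[cite: Geurdes2017, §2.5 eq. (2.18)–(2.19) p.6] -/
theorem not_Step3_fcrlInG : ¬ Step3_fcrlInG := by
  intro h
  have hc : (EuclideanSpace.single 2 1 : EuclideanSpace ℝ (Fin 3)) ≠ 0 := by
    intro h0
    have := congrArg (fun v : EuclideanSpace ℝ (Fin 3) => v 2) h0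
    simp at this
  have hG := h 1 zero_le_one _ hc U dataSubclass_U
  have e : fcrl 1 (EuclideanSpace.single 2 1) U =
      fun _ : ℝ => fun x => (2 * π + 1 + (2 * π) ^ 2) • U x :=
    funext fun t => funext fun x => fcrl_U t x
  rw [e] at hG
  refine not_hasRapidTimeDecay_of_stationary (x₀ := 0) ?_ hG.2.2
  rw [norm_smul, Real.norm_of_nonneg (by positivity)]
  nlinarith [one_le_norm_U_zero, Real.pi_pos, sq_nonneg (2 * π)]

end

end Summit.NavierStokesRegularity.NavierStokesRegularity.Theorems.Geurdes2017
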